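import Summits.CriticalPhenomena.CardyFormulaZ2.Theorems.CardyBoundaryCoulombGasBoundaryDefectGaussianRStubRigidityOfLocalLawsPart4
import Summits.CriticalPhenomena.CardyFormulaZ2.Theorems.CardyBoundaryCoulombGasBoundaryDefectGaussianRStubRigidityOfLocalLawsPart6

/-!
# Stub `stub_transportPaths` of line `rainbow-monomials-in-excursion-kernels` — Part 9:
# the boundary walk in lattice charts (flat rails, convex and reflex lattice corners)
# (crux `CardyBoundaryCoulombGas.BoundaryDefectGaussianR`, stmt-CriticalPhenomena-14132)

Lattice input (T3, discrete part) for the route execution of TRANSPORT. Coordinates at a lattice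
point `C` in the frame of an OUT-direction `K : Fin 4` (`dir K` points out of the domain, the walk
`dsucc` moves along `dir (K+1)` with the interior on its left): every point is written
`C + s • dir (K+1) + t • dir K`, and a lattice chart is a membership rule in `(s, t)`:

* flat rail through `C`: `∈ V ↔ t ≤ 0`;
* convex lattice corner `C` (out-direction turning from `K` to `K + 1`): `∈ V ↔ t ≤ 0 ∧ s ≤ 0`;
* reflex lattice corner `C` (out-direction turning from `K` to `K + 3`): `∈ V ↔ t ≤ 0 ∨ 0 ≤ s`.

Results: `tp_coord` (reading dot products with the four `dir`s off `(s, t)`), `tp_rail_local`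
(a flat rail point lies in `V`, has exactly one outside neighbour, `outDart = (C, K)`, and the walk
steps forward onto / from it), `tp_walk_run` (a run of forward steps), `tp_walk_convex`
(`j` steps in, one turn, `j'` steps out: `dsucc^[j' + 1 + j]`), `tp_walk_reflex` (`j - 1` steps in,
one diagonal step, `j' - 1` steps out). With `s3_cycle_orbit` these put the landing dart of a
corner jump on the boundary cycle of the take-off dart. All [folklore].
-/

noncomputable section

namespace Summit.CriticalPhenomena.CardyFormulaZ2.Cruxes.BoundaryDefectGaussianR.RainbowMonomialsInExcursionKernels

open Literature.Probability.LatticeModels Literature.Probability.LatticeModels.CollarLegModel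

/-! ### Direction algebra -/

/-- The four lattice directions. [folklore] -/
theorem tp_dir_val : dir 0 = (1, 0) ∧ dir 1 = (0, 1) ∧ dir 2 = (-1, 0) ∧ dir 3 = (0, -1) :=
  ⟨rfl, rfl, rfl, rfl⟩

/-- Opposite directions. [folklore] -/
theorem tp_dir_add_two (K : Fin 4) : dir (K + 2) = -dir K := by
  revert K; decide

/-- Opposite directions, shifted. [folklore] -/
theorem tp_dir_add_three (K : Fin 4) : dir (K + 3) = -dir (K + 1) := by
  revert K; decide

/-- Small `Fin 4` bookkeeping. [folklore] -/
theorem tp_fin4 (K : Fin 4) : K + 1 + 1 = K + 2 ∧ K + 2 + 1 = K + 3 ∧ K + 3 + 1 = K ∧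
    K + 1 + 2 = K + 3 ∧ K + 1 + 3 = K ∧ K + 3 + 3 = K + 2 := by
  revert K; decide

/-- **Coordinates in the frame of an out-direction.** For `X = C + s • dir (K+1) + t • dir K`:
the dot products of `X - C` with `dir K`, `dir (K+1)`, `dir (K+2)`, `dir (K+3)` are
`t, s, -t, -s`, and `‖X - C‖∞ ≤ |s| + |t|`. [folklore] -/
theorem tp_coord (K : Fin 4) (C : ℤ × ℤ) (s t : ℤ) :
    ((C + s • dir (K + 1) + t • dir K).1 - C.1) * (dir K).1 +
        ((C + s • dir (K + 1) + t • dir K).2 - C.2) * (dir K).2 = t ∧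
    ((C + s • dir (K + 1) + t • dir K).1 - C.1) * (dir (K + 1)).1 +
        ((C + s • dir (K + 1) + t • dir K).2 - C.2) * (dir (K + 1)).2 = s ∧
    ((C + s • dir (K + 1) + t • dir K).1 - C.1) * (dir (K + 2)).1 +
        ((C + s • dir (K + 1) + t • dir K).2 - C.2) * (dir (K + 2)).2 = -t ∧
    ((C + s • dir (K + 1) + t • dir K).1 - C.1) * (dir (K + 3)).1 +
        ((C + s • dir (K + 1) + t • dir K).2 - C.2) * (dir (K + 3)).2 = -s ∧
    max |(C + s • dir (K + 1) + t • dir K).1 - C.1| |(C + s • dir (K + 1) + t • dir K).2 - C.2| ≤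
      |s| + |t| := by
  obtain ⟨x, y⟩ := C
  have hs := abs_nonneg s
  have ht := abs_nonneg t
  fin_cases K <;> simp [tp_dir_val]

/-- Every point with `‖X - C‖∞ ≤ N` has frame coordinates: `X = C + s • dir (K+1) + t • dir K`
with `|s| + |t| ≤ 2N` (indeed `s, t` are the two dot products). [folklore] -/
theorem tp_coord_exists (K : Fin 4) (C X : ℤ × ℤ) :
    ∃ s t : ℤ, X = C + s • dir (K + 1) + t • dir K ∧
      |s| ≤ max |X.1 - C.1| |X.2 - C.2| ∧ |t| ≤ max |X.1 - C.1| |X.2 - C.2| := by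
  obtain ⟨x, y⟩ := C
  obtain ⟨p, q⟩ := X
  have e1 : |-(p - x)| = |p - x| := abs_neg _
  have e2 : |-(q - y)| = |q - y| := abs_neg _
  fin_cases K
  · exact ⟨q - y, p - x, by simp [tp_dir_val], le_max_right _ _, le_max_left _ _⟩
  · exact ⟨-(p - x), q - y, by simp [tp_dir_val], e1 ▸ le_max_left _ _,
      le_max_right _ _⟩
  · exact ⟨-(q - y), -(p - x), by simp [tp_dir_val], e2 ▸ le_max_right _ _,
      e1 ▸ le_max_left _ _⟩
  · exact ⟨p - x, -(q - y), by simp [tp_dir_val], le_max_left _ _, e2 ▸ le_max_right _ _⟩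

/-! ### A flat rail point -/

/-- **A flat rail point.** If near `C` (frame coordinates `|s| + |t| ≤ 2`) membership in `V` is
`t ≤ 0` (the domain is the closed half-plane behind the rail, `dir K` pointing out), then `C ∈ V`,
`C + dir K ∉ V`, `C` has exactly one lattice neighbour outside `V`, `outDart V C = (C, K)`, and the
boundary walk steps forward along the rail onto and from `C`:
`dsucc V (C, K) = (C + dir (K+1), K)`, `dsucc V (C - dir (K+1), K) = (C, K)`. [folklore] -/
theorem tp_rail_local (V : Finset (ℤ × ℤ)) (K : Fin 4) (C : ℤ × ℤ)
    (hmem : ∀ s t : ℤ, -2 ≤ s → s ≤ 2 → -2 ≤ t → t ≤ 2 →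
      (C + s • dir (K + 1) + t • dir K ∈ V ↔ t ≤ 0)) :
    C ∈ V ∧ C + dir K ∉ V ∧ ((neighbours C).filter (fun y => y ∉ V)).card = 1 ∧
      outDart V C = some (C, K) ∧ dsucc V (C, K) = (C + dir (K + 1), K) ∧
      dsucc V (C - dir (K + 1), K) = (C, K) := by
  have h00 : C ∈ V := by
    have e : C = C + (0 : ℤ) • dir (K + 1) + (0 : ℤ) • dir K := by module
    rw [e]; exact (hmem 0 0 (by norm_num) (by norm_num) (by norm_num) (by norm_num)).2 le_rfl
  have h01 : C + dir K ∉ V := by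
    have e : C + dir K = C + (0 : ℤ) • dir (K + 1) + (1 : ℤ) • dir K := by module
    rw [e]; intro h
    have := (hmem 0 1 (by norm_num) (by norm_num) (by norm_num) (by norm_num)).1 h
    omega
  have h10 : C + dir (K + 1) ∈ V := by
    have e : C + dir (K + 1) = C + (1 : ℤ) • dir (K + 1) + (0 : ℤ) • dir K := by module
    rw [e]; exact (hmem 1 0 (by norm_num) (by norm_num) (by norm_num) (by norm_num)).2 le_rfl
  have h11 : C + dir (K + 1) + dir K ∉ V := by
    have e : C + dir (K + 1) + dir K = C + (1 : ℤ) • dir (K + 1) + (1 : ℤ) • dir K := by module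
    rw [e]; intro h
    have := (hmem 1 1 (by norm_num) (by norm_num) (by norm_num) (by norm_num)).1 h
    omega
  have h2 : C + dir (K + 2) ∈ V := by
    have e : C + dir (K + 2) = C + (0 : ℤ) • dir (K + 1) + (-1 : ℤ) • dir K := by
      rw [tp_dir_add_two]; module
    rw [e]; exact (hmem 0 (-1) (by norm_num) (by norm_num) (by norm_num) (by norm_num)).2 (by norm_num)
  have h3 : C + dir (K + 3) ∈ V := by
    have e : C + dir (K + 3) = C + (-1 : ℤ) • dir (K + 1) + (0 : ℤ) • dir K := by
      rw [tp_dir_add_three]; module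
    rw [e]; exact (hmem (-1) 0 (by norm_num) (by norm_num) (by norm_num) (by norm_num)).2 le_rfl
  -- the unique outside neighbour
  have hnb : ∀ w, w ∈ neighbours C → ∃ k : Fin 4, w = C + dir k := by
    intro w hw
    obtain ⟨x, y⟩ := C
    simp only [neighbours, Finset.mem_insert, Finset.mem_singleton] at hw
    rcases hw with rfl | rfl | rfl | rfl
    · exact ⟨0, by simp [tp_dir_val]⟩
    · exact ⟨1, by simp [tp_dir_val]⟩
    · exact ⟨2, by simp [tp_dir_val, Prod.ext_iff]; ring⟩
    · exact ⟨3, by simp [tp_dir_val, Prod.ext_iff]; ring⟩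
  have hmemnb : ∀ k : Fin 4, C + dir k ∈ neighbours C := by
    intro k
    obtain ⟨x, y⟩ := C
    fin_cases k <;> simp [tp_dir_val, neighbours, sub_eq_add_neg]
  have hothers : ∀ K' k : Fin 4, k ≠ K' → k = K' + 1 ∨ k = K' + 2 ∨ k = K' + 3 := by decide
  have hcard : ((neighbours C).filter (fun y => y ∉ V)).card = 1 := by
    rw [Finset.card_eq_one]
    refine ⟨C + dir K, Finset.eq_singleton_iff_unique_mem.2
      ⟨Finset.mem_filter.2 ⟨hmemnb K, h01⟩, fun w hw => ?_⟩⟩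
    obtain ⟨hw, hwV⟩ := Finset.mem_filter.1 hw
    obtain ⟨k, rfl⟩ := hnb w hw
    by_cases hk : k = K
    · rw [hk]
    · exfalso
      rcases hothers K k hk with rfl | rfl | rfl
      · exact hwV h10
      · exact hwV h2
      · exact hwV h3
  obtain ⟨k, hk, -, huniq⟩ := s3_outDart_of_card V C hcard
  have hkK : K = k := huniq K h01
  subst hkK
  refine ⟨h00, h01, hcard, hk, (s3_dsucc_cases V C K).2.1 h10 h11, ?_⟩
  have h := (s3_dsucc_cases V (C - dir (K + 1)) K).2.1
  rw [sub_add_cancel] at h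
  exact h h00 h01

/-! ### Runs and corners -/

/-- **A run of forward steps.** If the `n` rail points `X + (i+1) • dir (K+1)`, `i < n`, ahead of
the dart `(X, K)` lie in `V` with their `dir K`-neighbours outside, then
`dsucc^[i] (X, K) = (X + i • dir (K+1), K)` for all `i ≤ n`. [folklore] -/
theorem tp_walk_run (V : Finset (ℤ × ℤ)) (K : Fin 4) (X : ℤ × ℤ) (n : ℕ)
    (hrail : ∀ i : ℕ, i < n → X + ((i : ℤ) + 1) • dir (K + 1) ∈ V ∧
      X + ((i : ℤ) + 1) • dir (K + 1) + dir K ∉ V) :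
    ∀ i : ℕ, i ≤ n → (dsucc V)^[i] (X, K) = (X + (i : ℤ) • dir (K + 1), K) := by
  intro i
  induction i with
  | zero => intro _; simp
  | succ i ih =>
    intro hi
    rw [Function.iterate_succ_apply', ih (by omega)]
    obtain ⟨h1, h2⟩ := hrail i (by omega)
    have e : X + (i : ℤ) • dir (K + 1) + dir (K + 1) = X + ((i : ℤ) + 1) • dir (K + 1) := by
      rw [add_smul, one_smul, add_assoc]
    have h := (s3_dsucc_cases V (X + (i : ℤ) • dir (K + 1)) K).2.1
    rw [e] at h
    rw [h h1 h2, Nat.cast_succ]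

/-- **Through a convex lattice corner.** At a convex lattice corner `C` (membership `t ≤ 0 ∧ s ≤ 0`
within frame distance `N`), the walk arriving along the rail `C - j • dir (K+1)` with out-direction
`K` reaches `C` in `j` steps, turns once (`(C, K) ↦ (C, K+1)`), and after `j'` more steps is at
`C + j' • dir (K+2)` with out-direction `K + 1` (`j, j' ≤ N - 2`). [folklore] -/
theorem tp_walk_convex (V : Finset (ℤ × ℤ)) (K : Fin 4) (C : ℤ × ℤ) (N : ℕ) (j j' : ℕ)
    (hj : j + 2 ≤ N) (hj' : j' + 2 ≤ N)
    (hmem : ∀ s t : ℤ, -(N : ℤ) ≤ s → s ≤ N → -(N : ℤ) ≤ t → t ≤ N →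
      (C + s • dir (K + 1) + t • dir K ∈ V ↔ t ≤ 0 ∧ s ≤ 0)) :
    (dsucc V)^[j' + 1 + j] (C - (j : ℤ) • dir (K + 1), K) =
      (C + (j' : ℤ) • dir (K + 1 + 1), K + 1) := by
  -- approach
  have hin : (dsucc V)^[j] (C - (j : ℤ) • dir (K + 1), K) = (C, K) := by
    have h := tp_walk_run V K (C - (j : ℤ) • dir (K + 1)) j (fun i hi => ?_) j le_rfl
    · rw [h, sub_add_cancel]
    have e1 : C - (j : ℤ) • dir (K + 1) + ((i : ℤ) + 1) • dir (K + 1) =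
        C + (-(j : ℤ) + i + 1) • dir (K + 1) + (0 : ℤ) • dir K := by module
    have e2 : C - (j : ℤ) • dir (K + 1) + ((i : ℤ) + 1) • dir (K + 1) + dir K =
        C + (-(j : ℤ) + i + 1) • dir (K + 1) + (1 : ℤ) • dir K := by module
    refine ⟨?_, ?_⟩
    · rw [e1]
      exact (hmem _ _ (by omega) (by omega) (by omega) (by omega)).2 ⟨le_rfl, by omega⟩
    · rw [e2]
      intro h
      have := (hmem _ _ (by omega) (by omega) (by omega) (by omega)).1 h
      omega
  -- turn
  have hturn : dsucc V (C, K) = (C, K + 1) := by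
    refine (s3_dsucc_cases V C K).1 ?_
    intro h
    have e : C + dir (K + 1) = C + (1 : ℤ) • dir (K + 1) + (0 : ℤ) • dir K := by module
    rw [e] at h
    have := (hmem 1 0 (by omega) (by omega) (by omega) (by omega)).1 h
    omega
  -- departure
  have hout : (dsucc V)^[j'] (C, K + 1) = (C + (j' : ℤ) • dir (K + 1 + 1), K + 1) := by
    refine tp_walk_run V (K + 1) C j' (fun i hi => ?_) j' le_rfl
    have hK2 : dir (K + 1 + 1) = -dir K := by rw [(tp_fin4 K).1, tp_dir_add_two]
    have e1 : C + ((i : ℤ) + 1) • dir (K + 1 + 1) =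
        C + (0 : ℤ) • dir (K + 1) + (-((i : ℤ) + 1)) • dir K := by rw [hK2]; module
    have e2 : C + ((i : ℤ) + 1) • dir (K + 1 + 1) + dir (K + 1) =
        C + (1 : ℤ) • dir (K + 1) + (-((i : ℤ) + 1)) • dir K := by rw [hK2]; module
    refine ⟨?_, ?_⟩
    · rw [e1]
      exact (hmem _ _ (by omega) (by omega) (by omega) (by omega)).2
        ⟨by omega, le_rfl⟩
    · rw [e2]
      intro h
      have := (hmem _ _ (by omega) (by omega) (by omega) (by omega)).1 h
      omega
  rw [Function.iterate_add_apply, Function.iterate_add_apply, hin, Function.iterate_one, hturn, hout]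

/-- **Through a reflex lattice corner.** At a reflex lattice corner `C` (membership
`t ≤ 0 ∨ 0 ≤ s` within frame distance `N`; `C` itself is an interior vertex), the walk arriving
along the rail `C - j • dir (K+1)` (`1 ≤ j`) with out-direction `K` makes `j - 1` forward steps,
one diagonal step `(C - dir (K+1), K) ↦ (C + dir K, K + 3)`, and after `j' - 1` more steps is at
`C + j' • dir K` with out-direction `K + 3` (`1 ≤ j'`; `j, j' ≤ N - 2`). [folklore] -/
theorem tp_walk_reflex (V : Finset (ℤ × ℤ)) (K : Fin 4) (C : ℤ × ℤ) (N : ℕ) (j j' : ℕ)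
    (hj1 : 1 ≤ j) (hj'1 : 1 ≤ j') (hj : j + 2 ≤ N) (hj' : j' + 2 ≤ N)
    (hmem : ∀ s t : ℤ, -(N : ℤ) ≤ s → s ≤ N → -(N : ℤ) ≤ t → t ≤ N →
      (C + s • dir (K + 1) + t • dir K ∈ V ↔ t ≤ 0 ∨ 0 ≤ s)) :
    (dsucc V)^[(j' - 1) + 1 + (j - 1)] (C - (j : ℤ) • dir (K + 1), K) =
      (C + (j' : ℤ) • dir (K + 3 + 1), K + 3) := by
  -- approach
  have hin : (dsucc V)^[j - 1] (C - (j : ℤ) • dir (K + 1), K) = (C - dir (K + 1), K) := by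
    have h := tp_walk_run V K (C - (j : ℤ) • dir (K + 1)) (j - 1) (fun i hi => ?_) (j - 1) le_rfl
    · rw [h, Nat.cast_sub hj1, Nat.cast_one]
      congr 1
      module
    have e1 : C - (j : ℤ) • dir (K + 1) + ((i : ℤ) + 1) • dir (K + 1) =
        C + (-(j : ℤ) + i + 1) • dir (K + 1) + (0 : ℤ) • dir K := by module
    have e2 : C - (j : ℤ) • dir (K + 1) + ((i : ℤ) + 1) • dir (K + 1) + dir K =
        C + (-(j : ℤ) + i + 1) • dir (K + 1) + (1 : ℤ) • dir K := by module
    refine ⟨?_, ?_⟩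
    · rw [e1]
      exact (hmem _ _ (by omega) (by omega) (by omega) (by omega)).2 (Or.inl le_rfl)
    · rw [e2]
      intro h
      have := (hmem _ _ (by omega) (by omega) (by omega) (by omega)).1 h
      omega
  -- the diagonal step
  have hdiag : dsucc V (C - dir (K + 1), K) = (C + dir K, K + 3) := by
    have h := (s3_dsucc_cases V (C - dir (K + 1)) K).2.2
    rw [sub_add_cancel] at h
    refine h ?_ ?_
    · have e : C = C + (0 : ℤ) • dir (K + 1) + (0 : ℤ) • dir K := by module
      rw [e]
      exact (hmem 0 0 (by omega) (by omega) (by omega) (by omega)).2 (Or.inl le_rfl)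
    · have e : C + dir K = C + (0 : ℤ) • dir (K + 1) + (1 : ℤ) • dir K := by module
      rw [e]
      exact (hmem 0 1 (by omega) (by omega) (by omega) (by omega)).2 (Or.inr le_rfl)
  -- departure
  have hK : dir (K + 3 + 1) = dir K := by rw [(tp_fin4 K).2.2.1]
  have hK3 : dir (K + 3) = -dir (K + 1) := tp_dir_add_three K
  have hout : (dsucc V)^[j' - 1] (C + dir K, K + 3) =
      (C + (j' : ℤ) • dir (K + 3 + 1), K + 3) := by
    have h := tp_walk_run V (K + 3) (C + dir K) (j' - 1) (fun i hi => ?_) (j' - 1) le_rfl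
    · rw [h, hK, Nat.cast_sub hj'1, Nat.cast_one]
      congr 1
      module
    have e1 : C + dir K + ((i : ℤ) + 1) • dir (K + 3 + 1) =
        C + (0 : ℤ) • dir (K + 1) + ((i : ℤ) + 2) • dir K := by rw [hK]; module
    have e2 : C + dir K + ((i : ℤ) + 1) • dir (K + 3 + 1) + dir (K + 3) =
        C + (-1 : ℤ) • dir (K + 1) + ((i : ℤ) + 2) • dir K := by rw [hK, hK3]; module
    refine ⟨?_, ?_⟩
    · rw [e1]
      exact (hmem _ _ (by omega) (by omega) (by omega) (by omega)).2 (Or.inr le_rfl)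
    · rw [e2]
      intro h
      have := (hmem _ _ (by omega) (by omega) (by omega) (by omega)).1 h
      omega
  rw [Function.iterate_add_apply, Function.iterate_add_apply, hin, Function.iterate_one, hdiag, hout]

/-- **Registered sub-goal `s7_walkConvex` of stub `stub_transportPaths`** (the boundary walk through
a convex lattice corner, one-line form of `tp_walk_convex`). [folklore] -/
theorem s7_walkConvex : ∀ (V : Finset (ℤ × ℤ)) (K : Fin 4) (C : ℤ × ℤ) (N j j' : ℕ), j + 2 ≤ N → j' + 2 ≤ N → (∀ s t : ℤ, -(N : ℤ) ≤ s → s ≤ N → -(N : ℤ) ≤ t → t ≤ N → (C + s • Literature.Probability.LatticeModels.CollarLegModel.dir (K + 1) + t • Literature.Probability.LatticeModels.CollarLegModel.dir K ∈ V ↔ t ≤ 0 ∧ s ≤ 0)) → (Literature.Probability.LatticeModels.CollarLegModel.dsucc V)^[j' + 1 + j] (C - (j : ℤ) • Literature.Probability.LatticeModels.CollarLegModel.dir (K + 1), K) = (C + (j' : ℤ) • Literature.Probability.LatticeModels.CollarLegModel.dir (K + 1 + 1), K + 1) :=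
  fun V K C N j j' hj hj' hmem => tp_walk_convex V K C N j j' hj hj' hmem

end Summit.CriticalPhenomena.CardyFormulaZ2.Cruxes.BoundaryDefectGaussianR.RainbowMonomialsInExcursionKernels

end
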